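import Summits.BirchSwinnertonDyer.BirchSwinnertonDyer.Theorems.PrintCFramBottomClassIndexLawFiveLeLevelDictionaryRationalEngines
import Summits.BirchSwinnertonDyer.BirchSwinnertonDyer.Theorems.PrintCFramBottomClassIndexLawFiveLeHerbrandOddIrregularWitnessGalois
import Literature.NumberTheory.GaloisRepresentations.AbsIntegersEquiv
import Literature.NumberTheory.GaloisRepresentations.FrobeniusPlaces
import HarnessLib

/-!
# Route `PrintCFram`, crux C2 `BottomClassIndexLawFiveLe` (stmt-BirchSwinnertonDyer-20372), line
# `eisenstein-resource-bdp-line` (registry v18; LEAD g10 report §2(d)(β), §4 `classFactor_imp_levelPos_or_sha`):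
# **THE (β) SOURCE, HOM-CURRENCY** — Mazur–Wiles (Ribet direction) + a NON-UNIT `B_{1,λ⁻¹}` PRODUCE, on
# `N = ker θ ≤ Γ_ℚ`, a continuous additive `θ`-equivariant function killing every `N ∩ I_𝔓` and not identically
# zero — the negation of the ODD engine's conclusion, i.e. the INPUT of w4 g8's inflation–restriction link
# (cell `bsd-print-cfram`, width seat `bsd-line-cfram-p1-w5` g3; helper `--supports` 20372; 0 defs, 0 facts,
# 0 sorry)

HONEST FRAMING. Nothing about BSD is proved here, and nothing of any stub; everything in §2 is CONDITIONAL on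
the named fact `MazurWiles1984.thm2_card_oddChiClassGroup_eq_bernoulli` (Mazur–Wiles Thm. 2, the EQUALITY —
only its Ribet direction is used; the Herbrand direction is a tree theorem, w5 g2 / w8 g2). This is the
converse twin of w6 g3's `LevelDictionaryAlpha.false_of_unramified_class_of_odd_avatar` (p671953) up to w4 g8's
link: there, an everywhere-unramified non-zero class of `H¹(ℚ, A)` is turned into a non-zero equivariant
homomorphism on `N = ker θ` (`LevelDictionary.hom_of_unramified_class`) and killed by the Herbrand direction;
here, Mazur–Wiles' converse direction (w6 g2's `HerbrandOddClassGroup.exists_absGaloisHom_ne_one_of_norm_bernoulli_lt_one`,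
a character `κ : Γ_L → 𝔽_p` on `L = ℚ̄^{ker θ}` with the eigen-law under the outer action of `Γ_ℚ`) is
TRANSPORTED back to `Γ_ℚ` along `res : Γ_L ≅ N ≤ Γ_ℚ` — the inverse of w4 g5's `HerbrandRationalTransport`
(which pulls functions on `N` back to `Γ_L`):

* §1 **`exists_addHom_on_range_of_absGaloisHom`** — `L/ℚ` finite Galois, `r : Γ_ℚ →* 𝔽_pˣ`,
  `κ : Γ_L →* 𝔽_p` (multiplicative notation) with `κ ≠ 1`, open kernel, trivial on the inertia group of every
  prime of `\bar ℤ_L`, and `κ(θ_γ σ) = κ(σ)^{r γ}` for the outer action `θ_γ = absGaloisOuterConj ℚ L γ`; THEN there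
  is `G : Γ_ℚ → 𝔽_p`, continuous on `N = res(Γ_L)`, additive on `N`, with `G(g n g⁻¹) = r(g)·G(n)`, killing
  `N ∩ I_𝔓` for every prime `𝔓` of `\bar ℤ` (every place), and NOT identically zero on `N`. (Primes of `\bar ℤ`
  lift to primes of `\bar ℤ_L` along `absIntegersEquiv`, `FrobeniusPlaces.exists_isPrime_comap_absIntegersMap_eq`;
  inertia corresponds, `AbsIntegersEquiv.comap_inertia_comap_absIntegersMap`.)
* §2 **`exists_addHom_of_odd_avatar_of_norm_bernoulli_lt_one`** — `A` a discrete `Γ_ℚ`-module of prime order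
  `p` (`p` odd) with continuous orbit maps, acted on non-trivially through `θ : Γ_ℚ →* 𝔽_pˣ`; `λ` a Dirichlet
  character (any level `n`) with `λ(χ_n τ) = Teich(θ τ)`, ODD, NOT congruent to the Teichmüller character, with
  `B_{1,λ̃⁻¹} ≠ 0` and `‖B_{1,λ̃⁻¹}‖_p < 1` (CLASS FACTOR NON-UNIT); `(hMW)`. THEN there is `G : Γ_ℚ → 𝔽_p`
  continuous and additive on `ker θ`, `θ`-equivariant, killing every `ker θ ∩ I_𝔓`, non-zero on `ker θ`;
  **`exists_equivariantHom_of_odd_avatar_of_norm_bernoulli_lt_one`** — the same valued in `A` itself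
  (`G₀ = e⁻¹ ∘ G`, `e : A ≃+ ℤ/p`): `G₀(g n g⁻¹) = g • G₀(n)` on `N = ker(Γ_ℚ → Aut A)` — LITERALLY the output
  shape of `LevelDictionary.hom_of_unramified_class`, hence the input of its converse (w4 g8's link
  `…LevelDictionaryDescent`, in flight), after which (β) reads: «class factor non-unit ⟹ an
  everywhere-unramified non-zero class of `H¹(ℚ, A)`» and p669667 / p672261 conclude LEVEL ≥ 1 or `Ш[p] ≠ 0`
  (rank one), `Ш[p] ≠ 0` (rank zero).

THEOREMS ONLY; no definition, no named fact, no `sorry`. BSD is not proved by any of this; no summit statement is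
proved by this seat. References: [NeukirchANT1999] Ch. I §9 (9.4)–(9.6), Ch. IV §1; [SerreGaloisCohomology1997]
I.§2.6 (b); [MazurWiles1984] Thm. 2 (p. 216); [Washington1997] §6.3, Thm. 6.17; the LEAD g10 report §2(d), §4.
-/

set_option autoImplicit false
-- `…BirchSwinnertonDyer.BirchSwinnertonDyer.Theorems…` is the problem's mandated namespace (D-0017).
set_option linter.dupNamespace false

noncomputable section

open scoped Classical Pointwise

namespace Summit.BirchSwinnertonDyer.BirchSwinnertonDyer.Theorems.PrintCFram.LevelDictionaryBeta

open NumberField IsDedekindDomain Field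
open Literature.NumberTheory.EllipticCurves Literature.NumberTheory.GaloisRepresentations
  Literature.NumberTheory.EllipticCurves.KrizLi2019 Literature.NumberTheory.NumberFields DirichletCharacter
open Summit.BirchSwinnertonDyer.BirchSwinnertonDyer.Theorems.PrintCFram.HerbrandSelmerToHom
open Summit.BirchSwinnertonDyer.BirchSwinnertonDyer.Theorems.PrintCFram.LevelDictionaryAlpha

variable {p : ℕ} [hp : Fact p.Prime]

/-! ## §1 The transport `Γ_L → res(Γ_L) ≤ Γ_ℚ` of an unramified eigen-character -/

section Transport

variable {L : Type} [Field L] [NumberField L]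

/-- `res⁻¹ : res(Γ_L) → Γ_L` is continuous (`res` is a closed embedding). [folklore] -/
theorem continuous_rangeInverse :
    Continuous (fun h : (absGaloisRestrict ℚ L).range =>
      (MonoidHom.ofInjective (f := (absGaloisRestrict ℚ L).toMonoidHom)
        (fun _ _ h => absGaloisRestrict_injective ℚ L h)).symm h) := by
  have hemb := (isClosedEmbedding_absGaloisRestrict ℚ L).isEmbedding
  have h1 : Continuous (fun h : (absGaloisRestrict ℚ L).range =>
      hemb.toHomeomorph.symm ⟨(h : absoluteGaloisGroup ℚ), h.2⟩) :=
    hemb.toHomeomorph.symm.continuous.comp (Continuous.subtype_mk continuous_subtype_val _)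
  refine h1.congr fun h => ?_
  apply absGaloisRestrict_injective ℚ L
  have hres : absGaloisRestrict ℚ L ((MonoidHom.ofInjective (f := (absGaloisRestrict ℚ L).toMonoidHom)
      (fun _ _ h => absGaloisRestrict_injective ℚ L h)).symm h) = h :=
    MonoidHom.apply_ofInjective_symm (f := (absGaloisRestrict ℚ L).toMonoidHom) _ h
  rw [hres]
  obtain ⟨h, ⟨γ, rfl⟩⟩ := h
  change absGaloisRestrict ℚ L (hemb.toHomeomorph.symm ⟨absGaloisRestrict ℚ L γ, _⟩) = _
  rw [Topology.IsEmbedding.toHomeomorph_symm_apply]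
  rfl

/-- **Inertia lifts along `res`.** If `res σ` lies in the inertia group of a prime `𝔓` of `\bar ℤ` above a place
`ℓ` of `ℚ`, then `σ` lies in the inertia group of a prime `𝔔` of `\bar ℤ_L` above a place `u` of `L` (namely
`𝔔 = ι(𝔓)` for `ι : \bar ℤ ≅ \bar ℤ_L`). [cite: NeukirchANT1999, Ch. I §9 (9.4)–(9.6)] -/
theorem exists_mem_inertia_of_absGaloisRestrict_mem {ℓ : HeightOneSpectrum (𝓞 ℚ)}
    {𝔓 : Ideal (absIntegers (𝓞 ℚ) ℚ)} (h𝔓 : 𝔓 ∈ ℓ.primesAbove) {σ : absoluteGaloisGroup L}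
    (hσ : absGaloisRestrict ℚ L σ ∈ 𝔓.inertia (absoluteGaloisGroup ℚ)) :
    ∃ (u : HeightOneSpectrum (𝓞 L)) (𝔔 : Ideal (absIntegers (𝓞 L) L)), 𝔔 ∈ u.primesAbove ∧
      σ ∈ 𝔔.inertia (absoluteGaloisGroup L) := by
  haveI := h𝔓.1
  obtain ⟨𝔔, h𝔔prime, h𝔔⟩ := exists_isPrime_comap_absIntegersMap_eq ℚ L 𝔓
  haveI := h𝔔prime
  obtain ⟨u, -, hu𝔔, -⟩ := exists_heightOneSpectrum_of_comap_absIntegersMap_mem_primesAbove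
    (K := ℚ) (M := L) (v := ℓ) (𝔔 := 𝔔) (by rw [h𝔔]; exact h𝔓)
  refine ⟨u, 𝔔, hu𝔔, ?_⟩
  rw [← comap_inertia_comap_absIntegersMap ℚ L 𝔔, Subgroup.mem_comap, h𝔔]
  exact hσ

/-- **THE TRANSPORT `Γ_L → N = res(Γ_L) ≤ Γ_ℚ` OF AN UNRAMIFIED EIGEN-CHARACTER.** `L/ℚ` finite Galois,
`r : Γ_ℚ →* 𝔽_pˣ`; `κ : Γ_L →* 𝔽_p` (multiplicative notation) with `κ ≠ 1`, OPEN kernel, trivial on the inertia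
group of every prime of `\bar ℤ_L` (every place of `L`), and the eigen-law `κ(θ_γ σ) = κ(σ)^{(r γ).val}` for the
outer action `θ_γ = absGaloisOuterConj ℚ L γ` of `Γ_ℚ` on `Γ_L`. THEN `G = κ ∘ res⁻¹` (extended by `0` off `N`)
is continuous on `N`, additive on `N`, satisfies `G(g n g⁻¹) = r(g) · G(n)` for all `g ∈ Γ_ℚ`, `n ∈ N`
(`res (θ_g σ) = g · res σ · g⁻¹`), kills `N ∩ I_𝔓` for every prime `𝔓` of `\bar ℤ` (inertia lifts along `res`),
and does not vanish identically on `N`. This is the converse bookkeeping of w4 g5's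
`HerbrandSelmerToHom.oddVanishQ_of_forall_character_field`. [cite: NeukirchANT1999, Ch. IV §1 and Ch. I §9 (9.4)–(9.6)] -/
theorem exists_addHom_on_range_of_absGaloisHom [IsGalois ℚ L] [NeZero p] (r : absoluteGaloisGroup ℚ →* (ZMod p)ˣ)
    (κ : absoluteGaloisGroup L →* Multiplicative (ZMod p)) (hκ1 : κ ≠ 1)
    (hopen : IsOpen (κ.ker : Set (absoluteGaloisGroup L)))
    (hinert : ∀ (u : HeightOneSpectrum (𝓞 L)) (𝔔 : Ideal (absIntegers (𝓞 L) L)), 𝔔 ∈ u.primesAbove →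
      ∀ g ∈ 𝔔.inertia (absoluteGaloisGroup L), κ g = 1)
    (heigen : ∀ (γ : absoluteGaloisGroup ℚ) (σ : absoluteGaloisGroup L),
      κ (Literature.NumberTheory.GaloisRepresentations.absGaloisOuterConj ℚ L γ σ) =
        (κ σ) ^ ((r γ : (ZMod p)ˣ) : ZMod p).val) :
    ∃ G : absoluteGaloisGroup ℚ → ZMod p,
      (Continuous fun n : (absGaloisRestrict ℚ L).range => G n) ∧
      (∀ a ∈ (absGaloisRestrict ℚ L).range, ∀ b ∈ (absGaloisRestrict ℚ L).range, G (a * b) = G a + G b) ∧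
      (∀ g, ∀ n ∈ (absGaloisRestrict ℚ L).range, G (g * n * g⁻¹) = ((r g : (ZMod p)ˣ) : ZMod p) * G n) ∧
      (∀ (ℓ : HeightOneSpectrum (𝓞 ℚ)) (𝔓 : Ideal (absIntegers (𝓞 ℚ) ℚ)), 𝔓 ∈ ℓ.primesAbove →
        ∀ n ∈ (absGaloisRestrict ℚ L).range, n ∈ 𝔓.inertia (absoluteGaloisGroup ℚ) → G n = 0) ∧
      ∃ n ∈ (absGaloisRestrict ℚ L).range, G n ≠ 0 := by
  -- the inverse `res⁻¹ : N → Γ_L`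
  let ι : (absGaloisRestrict ℚ L).range → absoluteGaloisGroup L := fun h =>
    (MonoidHom.ofInjective (f := (absGaloisRestrict ℚ L).toMonoidHom)
      (fun _ _ h => absGaloisRestrict_injective ℚ L h)).symm h
  have hι : ∀ σ : absoluteGaloisGroup L, ι ⟨absGaloisRestrict ℚ L σ, ⟨σ, rfl⟩⟩ = σ := fun σ =>
    absGaloisRestrict_injective ℚ L (MonoidHom.apply_ofInjective_symm _ _)
  -- `G = κ ∘ res⁻¹` on `N`, `0` elsewhere
  let G : absoluteGaloisGroup ℚ → ZMod p := fun g =>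
    if h : g ∈ (absGaloisRestrict ℚ L).range then Multiplicative.toAdd (κ (ι ⟨g, h⟩)) else 0
  have hG : ∀ σ : absoluteGaloisGroup L, G (absGaloisRestrict ℚ L σ) = Multiplicative.toAdd (κ σ) := fun σ => by
    simp only [G, dif_pos (show absGaloisRestrict ℚ L σ ∈ (absGaloisRestrict ℚ L).range from ⟨σ, rfl⟩), hι]
  have hGsub : ∀ h : (absGaloisRestrict ℚ L).range, G h = Multiplicative.toAdd (κ (ι h)) := fun h => by
    simp only [G, dif_pos h.2]
  refine ⟨G, ?_, ?_, ?_, ?_, ?_⟩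
  · -- continuity on `N`: `toAdd ∘ κ ∘ res⁻¹`
    have hκc : Continuous κ := by
      -- a homomorphism with open kernel into a discrete group is continuous
      -- (the tree's `MonoidHom.continuous_of_isOpen_ker`, inlined to keep the imports light)
      refine continuous_of_continuousAt_one κ ?_
      rw [ContinuousAt, map_one]
      refine fun U hU => Filter.mem_map.mpr (Filter.mem_of_superset (hopen.mem_nhds (by simp)) ?_)
      intro g hg
      rw [SetLike.mem_coe, MonoidHom.mem_ker] at hg
      rw [Set.mem_preimage, hg]
      exact mem_of_mem_nhds hU
    have hc : Continuous fun h : (absGaloisRestrict ℚ L).range => Multiplicative.toAdd (κ (ι h)) :=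
      continuous_of_discreteTopology.comp (hκc.comp continuous_rangeInverse)
    exact hc.congr fun h => (hGsub h).symm
  · rintro a ⟨σ, rfl⟩ b ⟨τ, rfl⟩
    change G (absGaloisRestrict ℚ L σ * absGaloisRestrict ℚ L τ) = G (absGaloisRestrict ℚ L σ) + G (absGaloisRestrict ℚ L τ)
    rw [← map_mul, hG, hG, hG, map_mul, toAdd_mul]
  · rintro g n ⟨σ, rfl⟩
    change G (g * absGaloisRestrict ℚ L σ * g⁻¹) = _ * G (absGaloisRestrict ℚ L σ)
    rw [← Literature.NumberTheory.GaloisRepresentations.absGaloisRestrict_absGaloisOuterConj, hG, hG, heigen,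
      toAdd_pow, nsmul_eq_mul, ZMod.natCast_zmod_val]
  · rintro ℓ 𝔓 h𝔓 n ⟨σ, rfl⟩ hnI
    obtain ⟨u, 𝔔, hu𝔔, hσ⟩ := exists_mem_inertia_of_absGaloisRestrict_mem h𝔓 hnI
    change G (absGaloisRestrict ℚ L σ) = 0
    rw [hG, hinert u 𝔔 hu𝔔 σ hσ, toAdd_one]
  · by_contra hall
    push Not at hall
    apply hκ1
    ext σ
    have h := hall (absGaloisRestrict ℚ L σ) ⟨σ, rfl⟩
    rw [hG, toAdd_eq_zero] at h
    rw [h, MonoidHom.one_apply]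

end Transport

/-! ## §2 The (β) source: Mazur–Wiles + class factor non-unit ⟹ a non-zero unramified equivariant homomorphism on `ker θ` -/

section Source

variable {A : Type} [AddCommGroup A] [DistribMulAction (absoluteGaloisGroup ℚ) A] [TopologicalSpace A] [DiscreteTopology A]

/-- **THE (β) SOURCE IN HOM-CURRENCY (CONDITIONAL on Mazur–Wiles Thm. 2, Ribet direction).** `A` a discrete
`Γ_ℚ`-module of prime order `p` (`p` odd) with continuous orbit maps, acted on non-trivially through the character
`θ : Γ_ℚ →* 𝔽_pˣ` (`θ g = 1 ↔ g` acts trivially); `λ` a Dirichlet character (any level `n`) with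
`λ(χ_n τ) = Teich(θ τ)` for all `τ ∈ Γ_ℚ`, ODD, NOT congruent to the Teichmüller character
(`¬ ∀ a, p ∤ a → ‖λ(a) − a‖ < 1`), with `B_{1,λ̃⁻¹} ≠ 0` and `‖B_{1,λ̃⁻¹}‖_p < 1` — the CLASS FACTOR NON-UNIT.
THEN, granted `(hMW)`, there is `G : Γ_ℚ → 𝔽_p`, continuous and additive on `N = ker θ`, with
`G(g n g⁻¹) = θ(g)·G(n)`, killing `N ∩ I_𝔓` for every prime `𝔓` of `\bar ℤ`, and not identically zero on `N` — the
NEGATION of the conclusion of the odd engine `HerbrandOddClassGroup.oddVanish_range_final_of_teichmuller_unconditional`.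
PROOF: on `L = ℚ̄^{ker θ}` (`LevelDictionaryAlpha.exists_field_of_character`: abelian, `p ∤ [L:ℚ]`, `res(Γ_L) = ker θ`)
Mazur–Wiles gives w6 g2's `κ : Γ_L → 𝔽_p` (`HerbrandOddClassGroup.exists_absGaloisHom_ne_one_of_norm_bernoulli_lt_one`,
for the primitive character `λ̃` and the lift `φ = Teich ∘ θ`); transport it by §1.
[cite: MazurWiles1984, Thm. 2 (p. 216)] [cite: Washington1997, §6.3 and Thm. 6.17] [cite: NeukirchANT1999, Ch. IV §1] -/
theorem exists_addHom_of_odd_avatar_of_norm_bernoulli_lt_one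
    (hMW : MazurWiles1984.thm2_card_oddChiClassGroup_eq_bernoulli) (hp2 : p ≠ 2) (hcard : Nat.card A = p)
    (hcont : ∀ a : A, Continuous fun g : absoluteGaloisGroup ℚ ↦ g • a)
    (θ : absoluteGaloisGroup ℚ →* (ZMod p)ˣ)
    (hker : ∀ g : absoluteGaloisGroup ℚ, θ g = 1 ↔ ∀ a : A, g • a = a)
    {n : ℕ} [NeZero n] (lam : DirichletCharacter ℚ_[p] n)
    (hlam : ∀ τ : absoluteGaloisGroup ℚ, lam ((modNCyclotomicCharacter ℚ n τ : (ZMod n)ˣ) : ZMod n) =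
      (((Kato2004.teichmullerChar p (θ τ) : ℤ_[p]ˣ) : ℤ_[p]) : ℚ_[p]))
    (hodd : lam.Odd)
    (hlamω : ¬ ∀ a : ℤ, ¬ ((p : ℤ) ∣ a) →
      ‖lam.primitiveCharacter (a : ZMod lam.conductor) - (a : ℚ_[p])‖ < 1)
    (hB0 : bernoulliOnePrim lam⁻¹ ≠ 0) (hB : ‖bernoulliOnePrim lam⁻¹‖ < 1) :
    ∃ G : absoluteGaloisGroup ℚ → ZMod p,
      (Continuous fun m : θ.ker => G m) ∧
      (∀ a ∈ θ.ker, ∀ b ∈ θ.ker, G (a * b) = G a + G b) ∧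
      (∀ g, ∀ m ∈ θ.ker, G (g * m * g⁻¹) = ((θ g : (ZMod p)ˣ) : ZMod p) * G m) ∧
      (∀ (ℓ : HeightOneSpectrum (𝓞 ℚ)) (𝔓 : Ideal (absIntegers (𝓞 ℚ) ℚ)), 𝔓 ∈ ℓ.primesAbove →
        ∀ m ∈ θ.ker, m ∈ 𝔓.inertia (absoluteGaloisGroup ℚ) → G m = 0) ∧
      ∃ m ∈ θ.ker, G m ≠ 0 := by
  haveI : NeZero p := ⟨hp.out.ne_zero⟩
  haveI : NeZero lam.conductor := ⟨lam.conductor_ne_zero⟩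
  -- the field `L = ℚ̄^{ker θ}`
  obtain ⟨L, _, _, _, hrange, hpL, hrL⟩ := exists_field_of_character θ (isOpen_ker_character hcard hcont θ hker)
  haveI : IsGalois ℚ L := IsAbelianGalois.toIsGalois
  have hNeq : (absGaloisRestrict ℚ L).range = θ.ker := by
    ext g
    rw [hrange g, MonoidHom.mem_ker]
  -- the lift `φ = Teich ∘ θ` and the primitive character `λ̃`
  let φ : absoluteGaloisGroup ℚ →* ℤ_[p]ˣ := (Kato2004.teichmullerChar p).comp θ
  have hφ : ∀ τ, φ τ = Kato2004.teichmullerChar p (θ τ) := fun τ => rfl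
  have hφL : ∀ σ : absoluteGaloisGroup L, φ (absGaloisRestrict ℚ L σ) = 1 := fun σ => by
    rw [hφ, hrL, map_one]
  have hr : ∀ τ : absoluteGaloisGroup ℚ, PadicInt.toZMod ((φ τ : ℤ_[p]ˣ) : ℤ_[p]) = ((θ τ : (ZMod p)ˣ) : ZMod p) :=
    fun τ => by rw [hφ, Kato2004.toZMod_teichmullerChar]
  have hdvd := lam.conductor_dvd_level
  have hψχ : ∀ u : (ZMod n)ˣ, lam (u : ZMod n) = lam.primitiveCharacter ((ZMod.unitsMap hdvd u : (ZMod lam.conductor)ˣ) :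
      ZMod lam.conductor) := fun u => by
    conv_lhs => rw [← DirichletCharacter.changeLevel_primitiveCharacter lam]
    rw [DirichletCharacter.changeLevel_eq_cast_of_dvd _ hdvd, ZMod.unitsMap_def, Units.coe_map, MonoidHom.coe_coe,
      ZMod.castHom_apply]
  have hprim : lam.primitiveCharacter.IsPrimitive := DirichletCharacter.primitiveCharacter_isPrimitive lam
  have hodd' : lam.primitiveCharacter.Odd := by
    have h := hψχ (-1)
    rw [ZMod.unitsMap_def, Units.map_neg_one, Units.val_neg, Units.val_one, Units.val_neg, Units.val_one] at h
    rw [DirichletCharacter.Odd, ← h]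
    exact hodd
  have hφχ : ∀ τ : absoluteGaloisGroup ℚ, (((φ τ : ℤ_[p]ˣ) : ℤ_[p]) : ℚ_[p]) =
      lam.primitiveCharacter ((modNCyclotomicCharacter ℚ lam.conductor τ : (ZMod lam.conductor)ˣ) :
        ZMod lam.conductor) :=
    fun τ => by rw [hφ, ← hlam τ, hψχ, Mazur1978.unitsMap_modNCyclotomicCharacter hdvd]
  have hBeq : bernoulliOnePrim lam.primitiveCharacter⁻¹ = bernoulliOnePrim lam⁻¹ := by
    rw [← RegularLocusBernoulliPair.bernoulliOnePrim_changeLevel hdvd, map_inv,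
      DirichletCharacter.changeLevel_primitiveCharacter]
  have hB0' : bernoulliOnePrim lam.primitiveCharacter⁻¹ ≠ 0 := by rw [hBeq]; exact hB0
  have hB' : ‖bernoulliOnePrim lam.primitiveCharacter⁻¹‖ < 1 := by rw [hBeq]; exact hB
  -- Mazur–Wiles on `L` (w6 g2)
  obtain ⟨κ, hκ1, hopen, hinert, heigen⟩ :=
    HerbrandOddClassGroup.exists_absGaloisHom_ne_one_of_norm_bernoulli_lt_one (L := L) hMW hp2 hpL hprim hodd'
      hlamω φ hφL hφχ hB0' hB' θ hr
  -- transport along `res : Γ_L ≅ ker θ`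
  obtain ⟨G, hGc, hGadd, hGconj, hGI, hGne⟩ := exists_addHom_on_range_of_absGaloisHom θ κ hκ1 hopen hinert heigen
  rw [hNeq] at hGadd hGconj hGI hGne
  refine ⟨G, ?_, hGadd, hGconj, hGI, hGne⟩
  -- continuity on the subtype `θ.ker = res(Γ_L)`
  have e : (fun m : θ.ker => G m) = (fun m : (absGaloisRestrict ℚ L).range => G m) ∘
      (fun m : θ.ker => (⟨(m : absoluteGaloisGroup ℚ), by rw [hNeq]; exact m.2⟩ : (absGaloisRestrict ℚ L).range)) := by
    funext m; rfl
  rw [e]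
  exact hGc.comp (Continuous.subtype_mk continuous_subtype_val _)

/-- **THE (β) SOURCE, VALUED IN `A` (the input shape of the inflation–restriction link).** Same binders as
`exists_addHom_of_odd_avatar_of_norm_bernoulli_lt_one`, plus the explicit action `g • a = θ(g) • a`. THEN there is
`G₀ : Γ_ℚ → A`, continuous and additive on `N = ker(Γ_ℚ → Aut A)`, `Γ_ℚ`-EQUIVARIANT (`G₀(g n g⁻¹) = g • G₀(n)`),
killing `N ∩ I_𝔓` for every prime `𝔓` of `\bar ℤ`, and not identically zero on `N` — literally the conclusion
shape of `LevelDictionary.hom_of_unramified_class` (w4 g8), i.e. the negation of «every such `G₀` vanishes».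
(`G₀ = e⁻¹ ∘ G` for an additive isomorphism `e : A ≃ ℤ/p`.) CONDITIONAL on `(hMW)`.
[cite: MazurWiles1984, Thm. 2 (p. 216)] [cite: SerreGaloisCohomology1997, I.§2.6 (b)] [cite: NeukirchANT1999, Ch. IV §1] -/
theorem exists_equivariantHom_of_odd_avatar_of_norm_bernoulli_lt_one
    (hMW : MazurWiles1984.thm2_card_oddChiClassGroup_eq_bernoulli) (hp2 : p ≠ 2) (hcard : Nat.card A = p)
    (hcont : ∀ a : A, Continuous fun g : absoluteGaloisGroup ℚ ↦ g • a)
    (θ : absoluteGaloisGroup ℚ →* (ZMod p)ˣ)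
    (hθ : ∀ (g : absoluteGaloisGroup ℚ) (a : A), g • a = (((θ g : ZMod p).val : ℕ) : ℤ) • a)
    (hker : ∀ g : absoluteGaloisGroup ℚ, θ g = 1 ↔ ∀ a : A, g • a = a)
    {n : ℕ} [NeZero n] (lam : DirichletCharacter ℚ_[p] n)
    (hlam : ∀ τ : absoluteGaloisGroup ℚ, lam ((modNCyclotomicCharacter ℚ n τ : (ZMod n)ˣ) : ZMod n) =
      (((Kato2004.teichmullerChar p (θ τ) : ℤ_[p]ˣ) : ℤ_[p]) : ℚ_[p]))
    (hodd : lam.Odd)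
    (hlamω : ¬ ∀ a : ℤ, ¬ ((p : ℤ) ∣ a) →
      ‖lam.primitiveCharacter (a : ZMod lam.conductor) - (a : ℚ_[p])‖ < 1)
    (hB0 : bernoulliOnePrim lam⁻¹ ≠ 0) (hB : ‖bernoulliOnePrim lam⁻¹‖ < 1) :
    ∃ G₀ : absoluteGaloisGroup ℚ → A,
      (Continuous fun m : (MulAction.toPermHom (absoluteGaloisGroup ℚ) A).ker => G₀ m) ∧
      (∀ a ∈ (MulAction.toPermHom (absoluteGaloisGroup ℚ) A).ker,
        ∀ b ∈ (MulAction.toPermHom (absoluteGaloisGroup ℚ) A).ker, G₀ (a * b) = G₀ a + G₀ b) ∧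
      (∀ (g : absoluteGaloisGroup ℚ), ∀ m ∈ (MulAction.toPermHom (absoluteGaloisGroup ℚ) A).ker,
        G₀ (g * m * g⁻¹) = g • G₀ m) ∧
      (∀ (ℓ : HeightOneSpectrum (𝓞 ℚ)) (𝔓 : Ideal (absIntegers (𝓞 ℚ) ℚ)), 𝔓 ∈ ℓ.primesAbove →
        ∀ m ∈ (MulAction.toPermHom (absoluteGaloisGroup ℚ) A).ker,
          m ∈ 𝔓.inertia (absoluteGaloisGroup ℚ) → G₀ m = 0) ∧
      ∃ m ∈ (MulAction.toPermHom (absoluteGaloisGroup ℚ) A).ker, G₀ m ≠ 0 := by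
  obtain ⟨G, hGc, hGadd, hGconj, hGI, hGne⟩ := exists_addHom_of_odd_avatar_of_norm_bernoulli_lt_one hMW hp2 hcard
    hcont θ hker lam hlam hodd hlamω hB0 hB
  have hN : (MulAction.toPermHom (absoluteGaloisGroup ℚ) A).ker = θ.ker := (ker_eq_ker_toPermHom θ hker).symm
  rw [hN]
  -- transport along `e : A ≃+ ℤ/p`
  haveI : IsAddCyclic A := isAddCyclic_of_prime_card hcard
  let e : A ≃+ ZMod p := addEquivOfAddCyclicCardEq (by rw [hcard, Nat.card_zmod])
  refine ⟨fun g => e.symm (G g), ?_, fun a ha b hb => ?_, fun g m hm => ?_, fun ℓ 𝔓 h𝔓 m hm hmI => ?_, ?_⟩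
  · exact continuous_of_discreteTopology.comp hGc
  · change e.symm (G (a * b)) = e.symm (G a) + e.symm (G b)
    rw [hGadd a ha b hb, map_add]
  · change e.symm (G (g * m * g⁻¹)) = g • e.symm (G m)
    apply e.injective
    rw [e.apply_symm_apply, hGconj g m hm, hθ g, map_zsmul, e.apply_symm_apply, zsmul_eq_mul, Int.cast_natCast,
      ZMod.natCast_zmod_val]
  · change e.symm (G m) = 0
    rw [hGI ℓ 𝔓 h𝔓 m hm hmI, map_zero]
  · obtain ⟨m, hm, hGm⟩ := hGne
    exact ⟨m, hm, fun h => hGm (e.symm.map_eq_zero_iff.1 h)⟩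

end Source

end Summit.BirchSwinnertonDyer.BirchSwinnertonDyer.Theorems.PrintCFram.LevelDictionaryBeta

end
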